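import Mathlib
import HarnessLib
import Summits.RiemannHypothesis.RiemannHypothesis.Theses.WeilParity
import Summits.RiemannHypothesis.RiemannHypothesis.Theses.GroundBarta
import Summits.RiemannHypothesis.RiemannHypothesis.Theorems.WeilParityEvenWinsBeyondArchSplit
import Summits.RiemannHypothesis.RiemannHypothesis.Theorems.WeilParityEvenWinsBeyondArchFrontier63
import Summits.RiemannHypothesis.RiemannHypothesis.Theorems.WeilParityEvenWinsBeyondArchFrontier67
import Summits.RiemannHypothesis.RiemannHypothesis.Theorems.WeilParityEvenWinsBeyondArchFrontierLogTwo
import Summits.RiemannHypothesis.RiemannHypothesis.Theorems.WeilGroundStateGroundStateSimpleEvenCellTransfer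
import Summits.RiemannHypothesis.RiemannHypothesis.Theorems.WeilGroundStateGroundStateSimpleEvenOfNoParityCrossing
import Summits.RiemannHypothesis.RiemannHypothesis.Theorems.WeilGroundStateGroundStateSimpleEvenOfOddSectorGap
import Summits.RiemannHypothesis.RiemannHypothesis.Theorems.WeilGroundStateGroundStateSimpleEvenTrialUpperH
import Summits.RiemannHypothesis.RiemannHypothesis.Theorems.WeilGroundStateGroundStateSimpleEvenOddLowerI65
import Summits.RiemannHypothesis.RiemannHypothesis.Theorems.WeilGroundStateGroundStateSimpleEvenOddLowerK67
import Summits.RiemannHypothesis.RiemannHypothesis.Theorems.WeilGroundStateGroundStateSimpleEvenOddLowerH69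

/-!
# The `{2,3}`-window is closed: `stub_twoThreeWindowSimpleEven` (item 18085, ladder stub 1) and the RH-free frontier at `log 2`

Support file for the cruxes `NoParityCrossing` (stmt-RiemannHypothesis-18085), `GroundStateSimpleEven` (stmt-RiemannHypothesis-1526)
and `EvenWinsBeyondArch` (stmt-RiemannHypothesis-15432; GroundBarta rung 4 = stmt-RiemannHypothesis-18807).

The LAST cell `H = [2/3, log 2]` of the `{2,3}`-window ladder is closed RH-free by the landed cell transfer
`GroundStateSimpleEven.weilWindowSimpleEven_on_cell_of_le` from

* the U-side `trialUpperH : ε(2/3) ≤ 1/100000000000` (exact-rational Rayleigh–Ritz, landed), and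
* the L-side `oddLowerH69 : Re Q(g) ≥ 1/10000000000` for odd normalised `g` on `[-log 2, log 2]` (the kernel-checked two-prime
  odd-sector margin certificate `weilCert23H`, `a₀ = 1733/2500 ⊇ log 2`, `N = 255`, `nb = 128`, multi-precision chain on `[0, 120]`;
  `Literature/…/WeilTwoPrimeOddMarginH*.lean`),

`1/100000000000 < 1/10000000000`, on top of the frontier `2/3` (`…Frontier67.lean`).  Consequences, all RH-free and sorry-free:

1. `stub_twoThreeWindowSimpleEven` — the REGISTERED ladder stub 1 of item 18085 with its signature verbatim
   (`∀ a, (log 3)/2 < a → a ≤ log 2 → WeilWindowSimpleEven a`), here as `exact` of the landed three-cell composition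
   `weilWindowSimpleEven_of_le_log_two_of_oddLower₃` fed with `oddLowerI65`, `oddLowerK67`, `oddLowerH69`;
2. `WeilWindowSimpleEven a`, the strict parity order `ε_ev(a) < ε_od(a)` and "every ground state is a.e. even" on EVERY window
   `0 < a ≤ log 2` (the whole range where at most the prime powers `2, 3` are visible);
3. item 18085 ↔ Connes' tail "no parity tie beyond `log 2`" ↔ `GroundStateSimpleEven`; the skeleton's composition with only the
   RH-strength stub left: `noParityCrossing_of_tailSimpleEven : (∀ a > log 2, WeilWindowSimpleEven a) → NoParityCrossing`;
4. `EvenWinsBeyondArch` (WeilParity) and GroundBarta's rung 4 from the tail alone; the even sector wins on every window `≤ log 2`.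

Mathlib + landed tree files only; no definitions, no named facts, no `sorry`.
-/

noncomputable section

open Set MeasureTheory

-- D-0017: single-problem summit ⇒ namespace `Summit.RiemannHypothesis.RiemannHypothesis.…` by design.
set_option linter.dupNamespace false

namespace Summit.RiemannHypothesis.RiemannHypothesis.Theorems.EvenWinsBeyondArch

open Literature.NumberTheory.LFunctions
open Summit.RiemannHypothesis.RiemannHypothesis.Theses.WeilParity
open Summit.RiemannHypothesis.RiemannHypothesis.Theses.WeilGroundState

/-! ## Cell `H = [2/3, log 2]` and the registered stub -/

/-- **Cell `H`**: `WeilWindowSimpleEven a` for every `2/3 ≤ a ≤ log 2` (cell transfer with `U = 1/10¹¹ < L = 1/10¹⁰`). [folklore] -/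
theorem weilWindowSimpleEven_on_cell_H {a : ℝ} (hlo : (2 / 3 : ℝ) ≤ a) (hhi : a ≤ Real.log 2) :
    WeilWindowSimpleEven a :=
  GroundStateSimpleEven.weilWindowSimpleEven_on_cell_of_le (b := 2 / 3) (c := Real.log 2)
    (U := 1 / 100000000000) (L := 1 / 10000000000) (by norm_num) (by norm_num)
    Summit.RiemannHypothesis.RiemannHypothesis.Theorems.trialUpperH
    Summit.RiemannHypothesis.RiemannHypothesis.Theorems.oddLowerH69 hlo hhi

/-- **LADDER STUB 1 of item 18085 (`stub_twoThreeWindowSimpleEven`, registered signature verbatim): the Connes–van Suijlekom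
clause on the whole `{2,3}`-window `(log 3)/2 < a ≤ log 2`.**  RH-free: the three-cell composition
`weilWindowSimpleEven_of_le_log_two_of_oddLower₃` (U-sides `trialUpperG/K/H`, cells A–F below `63/100`) fed with the three
kernel-checked odd-sector margin certificates `oddLowerI65` (`5·10⁻¹⁰` at `13/20`), `oddLowerK67` (`5·10⁻¹⁰` at `2/3`),
`oddLowerH69` (`10⁻¹⁰` at `log 2`). [folklore] -/
theorem stub_twoThreeWindowSimpleEven :
    ∀ a : ℝ, Real.log 3 / 2 < a → a ≤ Real.log 2 →
      Literature.NumberTheory.LFunctions.WeilWindowSimpleEven a :=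
  fun a ha hle ↦ weilWindowSimpleEven_of_le_log_two_of_oddLower₃
    (L₁ := 1 / 2000000000) (L₂ := 1 / 2000000000) (L₃ := 1 / 10000000000) (by norm_num)
    Summit.RiemannHypothesis.RiemannHypothesis.Theorems.oddLowerI65 (by norm_num)
    Summit.RiemannHypothesis.RiemannHypothesis.Theorems.oddLowerK67 (by norm_num)
    Summit.RiemannHypothesis.RiemannHypothesis.Theorems.oddLowerH69 a
    (lt_trans (div_pos (Real.log_pos (by norm_num)) two_pos) ha) hle

/-- `stub_twoThreeWindowSimpleEven` under a descriptive name: the Connes–van Suijlekom clause on the `{2,3}`-window. [folklore] -/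
theorem twoThreeWindowSimpleEven :
    ∀ a : ℝ, Real.log 3 / 2 < a → a ≤ Real.log 2 → WeilWindowSimpleEven a :=
  stub_twoThreeWindowSimpleEven

/-- **The Connes–van Suijlekom hypothesis on every window `0 < a ≤ log 2` (RH-free)**: up to `2/3`
(`weilWindowSimpleEven_of_le_two_thirds`) and the last cell `H`. [folklore] -/
theorem weilWindowSimpleEven_of_le_log_two : ∀ a : ℝ, 0 < a → a ≤ Real.log 2 → WeilWindowSimpleEven a := by
  intro a ha hhi
  rcases le_or_gt a (2 / 3) with hle | hlt
  · exact weilWindowSimpleEven_of_le_two_thirds a ha hle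
  · exact weilWindowSimpleEven_on_cell_H hlt.le hhi

/-- **Strict parity order up to `log 2`**: `ε_ev(a) < ε_od(a)` for `0 < a ≤ log 2`. RH-free. [folklore] -/
theorem weilEvenGroundEnergy_lt_weilOddGroundEnergy_of_le_log_two {a : ℝ} (ha : 0 < a) (hhi : a ≤ Real.log 2) :
    weilEvenGroundEnergy a < weilOddGroundEnergy a :=
  (weilWindowSimpleEven_iff_weilEvenGroundEnergy_lt ha).1 (weilWindowSimpleEven_of_le_log_two a ha hhi)

/-- **Every ground state at every window `0 < a ≤ log 2` is a.e. even.** [folklore] -/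
theorem groundStates_ae_even_of_le_log_two :
    ∀ a : ℝ, 0 < a → a ≤ Real.log 2 → ∀ u : ℝ → ℂ, IsWeilGroundState a u → u =ᵐ[volume] fun t ↦ u (-t) :=
  fun a ha hhi ↦ (GroundStateSimpleEven.weilWindowSimpleEven_iff_groundStates_ae_even ha).1
    (weilWindowSimpleEven_of_le_log_two a ha hhi)

/-! ## The residue: Connes' tail beyond `log 2` (ladder stub 2, RH-strength) -/

/-- **No tie beyond `log 2` ⟹ `NoParityCrossing`** (item stmt-RiemannHypothesis-18085), now certificate-free in its hypotheses. [folklore] -/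
theorem noParityCrossing_of_beyond_log_two
    (h : ∀ a : ℝ, Real.log 2 < a → weilEvenGroundEnergy a ≠ weilOddGroundEnergy a) : NoParityCrossing := by
  intro a ha
  rcases le_or_gt a (Real.log 2) with hle | hlt
  · have ha0 : 0 < a := lt_trans (div_pos (Real.log_pos (by norm_num)) two_pos) ha
    exact ne_of_lt (weilEvenGroundEnergy_lt_weilOddGroundEnergy_of_le_log_two ha0 hle)
  · exact h a hlt

/-- **Item 18085 after the `{2,3}`-window: `NoParityCrossing` ↔ no parity tie beyond `log 2`.** [folklore] -/
theorem noParityCrossing_iff_beyond_log_two :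
    NoParityCrossing ↔ ∀ a : ℝ, Real.log 2 < a → weilEvenGroundEnergy a ≠ weilOddGroundEnergy a :=
  ⟨beyond_log_two_of_noParityCrossing, noParityCrossing_of_beyond_log_two⟩

/-- **The ladder skeleton with stub 1 discharged**: Connes' clause on the tail `a > log 2` (the registered RH-strength stub
`stub_tailSimpleEven`) alone now proves item 18085 (composition `noParityCrossing_of_stubs` of the registered line `ladder`,
restated here with stub 1 supplied). [folklore] -/
theorem noParityCrossing_of_tailSimpleEven
    (h₂ : ∀ a : ℝ, Real.log 2 < a → Literature.NumberTheory.LFunctions.WeilWindowSimpleEven a) : NoParityCrossing :=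
  noParityCrossing_of_beyond_log_two fun a ha ↦
    ((weilWindowSimpleEven_iff_weilEvenGroundEnergy_lt (lt_trans (Real.log_pos (by norm_num)) ha)).1 (h₂ a ha)).ne

/-- **`GroundStateSimpleEven` (stmt-RiemannHypothesis-1526) ↔ no parity tie beyond `log 2`.** [folklore] -/
theorem groundStateSimpleEven_iff_noParityCrossingBeyond_log_two :
    GroundStateSimpleEven ↔ ∀ a : ℝ, Real.log 2 < a → weilEvenGroundEnergy a ≠ weilOddGroundEnergy a :=
  GroundStateSimpleEven.groundStateSimpleEven_iff_noParityCrossing.trans noParityCrossing_iff_beyond_log_two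

/-- **`GroundStateSimpleEven` ↔ Connes' clause on the tail `a > log 2`** (on `(0, log 2]` the clause is now a theorem). [folklore] -/
theorem groundStateSimpleEven_iff_tailSimpleEven :
    GroundStateSimpleEven ↔ ∀ a : ℝ, Real.log 2 < a → WeilWindowSimpleEven a := by
  refine ⟨fun h a ha ↦ h a (lt_trans (Real.log_pos (by norm_num)) ha), fun h a ha ↦ ?_⟩
  rcases le_or_gt a (Real.log 2) with hle | hlt
  · exact weilWindowSimpleEven_of_le_log_two a ha hle
  · exact h a hlt

/-- **The crux `EvenWinsBeyondArch` from "no tie beyond `log 2`"** (landed split glue, no certificate hypotheses left). [folklore] -/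
theorem evenWinsBeyondArch_of_noTie_beyond_log_two
    (hne : ∀ a : ℝ, Real.log 2 < a → weilEvenGroundEnergy a ≠ weilOddGroundEnergy a) : EvenWinsBeyondArch :=
  evenWinsBeyondArch_of_subs WeilParity.onePrimeWindowSimpleEven_proof (noParityCrossing_of_beyond_log_two hne)

/-- **The crux `EvenWinsBeyondArch` from Connes' clause on the tail.** [folklore] -/
theorem evenWinsBeyondArch_of_tailSimpleEven
    (h₂ : ∀ a : ℝ, Real.log 2 < a → WeilWindowSimpleEven a) : EvenWinsBeyondArch :=
  evenWinsBeyondArch_of_subs WeilParity.onePrimeWindowSimpleEven_proof (noParityCrossing_of_tailSimpleEven h₂)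

/-- **What the crux still asserts**: `EvenWinsBeyondArch ↔ ∀ a > log 2, ε_ev(a) ≤ ε_od(a)`. [folklore] -/
theorem evenWinsBeyondArch_iff_forall_le_beyond_log_two :
    EvenWinsBeyondArch ↔ ∀ a : ℝ, Real.log 2 < a → weilEvenGroundEnergy a ≤ weilOddGroundEnergy a := by
  rw [evenWinsBeyondArch_iff_forall_le]
  refine ⟨fun h a ha ↦ h a (lt_trans (by have := Real.log_two_lt_d9; have := Real.log_two_gt_d9; linarith) ha),
    fun h a ha ↦ ?_⟩
  rcases le_or_gt a (Real.log 2) with hle | hlt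
  · exact (weilEvenGroundEnergy_lt_weilOddGroundEnergy_of_le_log_two (log_two_half_pos.trans ha) hle).le
  · exact h a hlt

/-- **A failure of the crux forces an exact parity tie at some window `a > log 2`** (three or more prime powers visible). [folklore] -/
theorem exists_tie_beyond_log_two_of_not_evenWinsBeyondArch (h : ¬ EvenWinsBeyondArch) :
    ∃ a : ℝ, Real.log 2 < a ∧ weilEvenGroundEnergy a = weilOddGroundEnergy a := by
  by_contra hne
  push Not at hne
  exact h (evenWinsBeyondArch_of_noTie_beyond_log_two hne)

end Summit.RiemannHypothesis.RiemannHypothesis.Theorems.EvenWinsBeyondArch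

/-! ## The route thesis on every window up to `log 2`, and the GroundBarta transport -/

namespace Summit.RiemannHypothesis.RiemannHypothesis.Theorems.WeilParity

open Literature.NumberTheory.LFunctions

/-- **The even sector wins on every window `0 < a ≤ log 2`** (RH-free): every odd `L²`-normalised Weil test on `[-a, a]`
is matched up to any `δ > 0` by an even one. [folklore] -/
theorem evenSectorWins_upTo_logTwo :
    ∀ a : ℝ, 0 < a → a ≤ Real.log 2 → ∀ o : ℝ → ℂ,
      Literature.NumberTheory.LFunctions.IsWeilTest o → tsupport o ⊆ Set.Icc (-a) a →
      (∀ t, o (-t) = -o t) → ∫ t, ‖o t‖ ^ 2 = (1 : ℝ) → ∀ δ : ℝ, 0 < δ →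
        ∃ e : ℝ → ℂ, Literature.NumberTheory.LFunctions.IsWeilTest e ∧ tsupport e ⊆ Set.Icc (-a) a ∧
          (∀ t, e (-t) = e t) ∧ ∫ t, ‖e t‖ ^ 2 = (1 : ℝ) ∧
          (Literature.NumberTheory.LFunctions.weilQuadratic e).re ≤
            (Literature.NumberTheory.LFunctions.weilQuadratic o).re + δ :=
  fun _ ha hle ↦ evenWinsAt_of_le ha
    (EvenWinsBeyondArch.weilEvenGroundEnergy_lt_weilOddGroundEnergy_of_le_log_two ha hle).le

end Summit.RiemannHypothesis.RiemannHypothesis.Theorems.WeilParity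

namespace Summit.RiemannHypothesis.RiemannHypothesis.Theorems.GroundBarta

open Literature.NumberTheory.LFunctions

/-- **GroundBarta's rung 4 from "no tie beyond `log 2`"** (transport along the `Iff.rfl` copy
`GroundBarta.evenWinsBeyondArch_iff_weilParity`; no certificate hypotheses left). [folklore] -/
theorem evenWinsBeyondArch_of_noTie_beyond_log_two
    (hne : ∀ a : ℝ, Real.log 2 < a → weilEvenGroundEnergy a ≠ weilOddGroundEnergy a) :
    Summit.RiemannHypothesis.RiemannHypothesis.Theses.GroundBarta.EvenWinsBeyondArch :=
  evenWinsBeyondArch_iff_weilParity.2 (EvenWinsBeyondArch.evenWinsBeyondArch_of_noTie_beyond_log_two hne)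

/-- **GroundBarta's rung 4 from Connes' clause on the tail `a > log 2`.** [folklore] -/
theorem evenWinsBeyondArch_of_tailSimpleEven
    (h₂ : ∀ a : ℝ, Real.log 2 < a → WeilWindowSimpleEven a) :
    Summit.RiemannHypothesis.RiemannHypothesis.Theses.GroundBarta.EvenWinsBeyondArch :=
  evenWinsBeyondArch_iff_weilParity.2 (EvenWinsBeyondArch.evenWinsBeyondArch_of_tailSimpleEven h₂)

/-- **What GroundBarta's rung 4 still asserts**: `↔ ∀ a > log 2, ε_ev(a) ≤ ε_od(a)`. [folklore] -/
theorem evenWinsBeyondArch_iff_forall_le_beyond_log_two :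
    Summit.RiemannHypothesis.RiemannHypothesis.Theses.GroundBarta.EvenWinsBeyondArch ↔
      ∀ a : ℝ, Real.log 2 < a → weilEvenGroundEnergy a ≤ weilOddGroundEnergy a :=
  evenWinsBeyondArch_iff_weilParity.trans EvenWinsBeyondArch.evenWinsBeyondArch_iff_forall_le_beyond_log_two

end Summit.RiemannHypothesis.RiemannHypothesis.Theorems.GroundBarta

end
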